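import Summits.QuantumFields.QCD.Theorems.WilsonMobilityGapMobilityGapSketchFreeReduction
import Summits.QuantumFields.QCD.Theorems.WilsonMobilityGapMobilityGapStubLower

/-!
# Crux `MobilityGap` (stmt-QuantumFields-9150) — line `Sketch` with FREE DATA: the threshold along a datum is attained

Helpers toward the registered stub `stub_lowerAt` (= `LawLowerFree`, clause (iii) in the window above the threshold
along every light datum): the order-theoretic threshold `thrD d δ k = sInf (floorSetD d δ k)` is a MINIMUM, the set of
certified tuples is closed, a near-degenerate tuple at or above the threshold is certified, and failures of the
certificate accumulate strictly below a genuine threshold — ports to the free line of the pinned attainment package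
(`…StubLower.lean`, p114919), resting on the landed continuity of the phase-quenched fractional moment in the bare
masses (`continuous_fm_mass`, exponent `d.s ∈ (0,1)`).  Registered sub-goal: `isClosed_setOf_certifiedD`.
-/

noncomputable section

namespace Summit.QuantumFields.QCD.Theorems.MobilityGapSketch

open scoped BigOperators Topology
open MeasureTheory Filter Set
open Literature.MathematicalPhysics.QuantumFieldTheory Literature.MathematicalPhysics.QuantumLattice
  Literature.Probability.LatticeModels

variable {Nf : ℕ}

/-- The set of certified bare tuples along `d` is closed (sub-level sets of the continuous
`t ↦ fm Nf β_k t S f v d.s`, landed `continuous_fm_mass`, over `S ≥ L⁰_k`, `f`, `v ∈ box S`). -/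
theorem isClosed_setOf_certifiedD :
    ∀ {Nf : ℕ} (d : LineData Nf) (δ : ℝ) (k : ℕ), IsClosed {t : Fin Nf → ℝ | CertifiedD d δ k t} := by
  intro Nf d δ k
  have h : {t : Fin Nf → ℝ | CertifiedD d δ k t} =
      ⋂ S : ℕ, ⋂ (_ : d.vfloor k ≤ S), ⋂ f : Fin Nf, ⋂ v : Literature.Probability.LatticeModels.Site 4,
        ⋂ (_ : v ∈ box 4 S),
          {t : Fin Nf → ℝ | fm Nf (d.β k) t S f v d.s ≤ Real.exp δ * Real.exp (-(δ * (d.a k * ‖v‖)))} := by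
    ext t
    simp only [CertifiedD, mem_iInter, mem_setOf_eq]
  rw [h]
  exact isClosed_iInter fun S => isClosed_iInter fun _ => isClosed_iInter fun f =>
    isClosed_iInter fun v => isClosed_iInter fun _ =>
      isClosed_le (continuous_fm_mass Nf (d.β k) S f v d.s_pos.le d.s_lt_one) continuous_const

/-- **The threshold along `d` is attained**: `thrD d δ k ∈ floorSetD d δ k` as soon as some floor is good
(good floors `u_n ↓ thrD`, shifted tuples `t + (u_n - thrD)` are certified and tend to `t`, closedness). -/
theorem thrD_mem_floorSetD {d : LineData Nf} {δ : ℝ} {k : ℕ} (hne : (floorSetD d δ k).Nonempty) :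
    thrD d δ k ∈ floorSetD d δ k := by
  refine ⟨neg_one_le_thrD hne, fun t ht hsp => ?_⟩
  obtain ⟨u, -, hu, hmem⟩ := exists_seq_tendsto_sInf hne (floorSetD_bddBelow d δ k)
  change Tendsto u atTop (𝓝 (thrD d δ k)) at hu
  have hcert : ∀ n, CertifiedD d δ k (fun f => t f + (u n - thrD d δ k)) := fun n =>
    (hmem n).2 _ (fun f => by linarith [ht f]) fun f g => by
      rw [add_sub_add_right_eq_sub]; exact hsp f g
  have hlim : Tendsto (fun n => fun f => t f + (u n - thrD d δ k)) atTop (𝓝 t) := by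
    refine tendsto_pi_nhds.2 fun f => ?_
    have h := (tendsto_const_nhds (x := t f)).add (hu.sub_const (thrD d δ k))
    simpa using h
  exact (isClosed_setOf_certifiedD d δ k).mem_of_tendsto hlim (Eventually.of_forall hcert)

/-- The floor set along `d` is the closed ray `[thrD, ∞)` once non-empty. -/
theorem floorSetD_eq_Ici {d : LineData Nf} {δ : ℝ} {k : ℕ} (hne : (floorSetD d δ k).Nonempty) :
    floorSetD d δ k = Ici (thrD d δ k) := by
  ext u
  refine ⟨fun hu => thrD_le_of_mem hu, fun hu => ?_⟩
  exact ⟨(neg_one_le_thrD hne).trans hu, isGoodFloorD_mono hu (thrD_mem_floorSetD hne).2⟩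

/-- Closed-window lever along `d`: a tuple of spread `≤ w_k` with all components AT OR ABOVE the threshold is
certified. -/
theorem certifiedD_of_thrD_le {d : LineData Nf} {δ : ℝ} {k : ℕ} (hne : (floorSetD d δ k).Nonempty)
    {t : Fin Nf → ℝ} (ht : ∀ f, thrD d δ k ≤ t f) (hsp : ∀ f g, |t f - t g| ≤ d.slab k) :
    CertifiedD d δ k t :=
  (thrD_mem_floorSetD hne).2 t ht hsp

/-- An uncertified near-degenerate tuple along `d` dips STRICTLY below the threshold in some flavour. -/
theorem exists_lt_thrD_of_not_certifiedD {d : LineData Nf} {δ : ℝ} {k : ℕ} (hne : (floorSetD d δ k).Nonempty)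
    {t : Fin Nf → ℝ} (hsp : ∀ f g, |t f - t g| ≤ d.slab k) (h : ¬ CertifiedD d δ k t) :
    ∃ f, t f < thrD d δ k := by
  by_contra hcon
  push Not at hcon
  exact h (certifiedD_of_thrD_le hne hcon hsp)

/-- **Failures of the certificate accumulate at a genuine threshold from below** (along `d`): if
`-1 < thrD d δ k`, then for every `ε > 0` some tuple of spread `≤ w_k` with all components `> thrD - ε` and one
component `< thrD` is NOT certified — the datum a no-jump law (`stub_lowerAt`) must convert into clause (iii)
just above `thrD`. -/
theorem exists_not_certifiedD_near_thrD {d : LineData Nf} {δ : ℝ} {k : ℕ} (hne : (floorSetD d δ k).Nonempty)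
    (hthr : -1 < thrD d δ k) {ε : ℝ} (hε : 0 < ε) :
    ∃ t : Fin Nf → ℝ, (∀ f, thrD d δ k - ε < t f) ∧ (∃ f, t f < thrD d δ k) ∧
      (∀ f g, |t f - t g| ≤ d.slab k) ∧ ¬ CertifiedD d δ k t := by
  set x : ℝ := max (-1) (thrD d δ k - ε / 2) with hx
  have hxlt : x < thrD d δ k := max_lt hthr (by linarith)
  have hxng : ¬ IsGoodFloorD d δ k x := fun hgood =>
    (thrD_le_of_mem ⟨le_max_left _ _, hgood⟩).not_gt hxlt
  unfold IsGoodFloorD at hxng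
  push Not at hxng
  obtain ⟨t, hxt, hsp, hnc⟩ := hxng
  refine ⟨t, fun f => ?_, exists_lt_thrD_of_not_certifiedD hne hsp hnc, hsp, hnc⟩
  have : thrD d δ k - ε < x := (by linarith : thrD d δ k - ε < thrD d δ k - ε / 2).trans_le
    (le_max_right _ _)
  exact this.trans_le (hxt f)

end Summit.QuantumFields.QCD.Theorems.MobilityGapSketch

end
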